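import Summits.QuantumFields.YangMills.Theorems.UnitScaleTiltProp8HalvingELMinimality
import HarnessLib

/-!
# Route `UnitScaleTilt`, crux K1 child «MinimiserStabilityRegPr» (stmt-QuantumFields-19200), registered stub V2′ `stub_halvingStep`
# (skeletons v8 5b4e846794b80374 ∕ v10 `BirthV10`) — **THE TRACE PAIRING ON `ker Q` FROM A CONSTRAINED MINIMUM, 𝔰𝔲(2)-VALUED COMPETITORS** (owner row M3, the
# `hcrit` junction — repair (R1) of the seat's LOCATED ✗ 2026-08-28 on ✓ p604227 `HalvingELMinimality.tracePairing_of_isMinOn`: its chart hypothesis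
# `↑(U X)(b) = e^{iηX(b)} ∈ SU(2)` on `T = {self-adjoint ∧ constraints ∧ S}` is unsatisfiable — `det e^{iηX(b)} = e^{iη tr X(b)}` and `T` contains `A + t·(s•1)`,
# `s ∈ ker Q ∖ 0` — so the theorem is vacuous; HERE `T_𝔰𝔲` adds «bondwise traceless», on which the chart exists (`exp(i·𝔰𝔲(2)) ⊂ SU(2)`), and the tests `E` are
# traceless — the hypothesis (i) of ✓ `HalvingA1Row165TraceSU2.row165_of_tracePairing_L5_su2`)

Cell `ym3-torus` (HUMAN RULING D-0037, YM ladder rung R3 — continuum SU(2) YM₃ on the torus is a RUNG, not the Clay problem), width seat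
`ym-ust-19200-w7` gen 0 (D-0154 (3c)).  `--supports stmt-QuantumFields-19200 --as helper`; def-free, 0 sorry, standard axioms.

THE PRINT ([Balaban1985Variational] p. 297): *«we obtain the following equation on A′₁, … (127) for all δA′ satisfying QδA′ = 0»* — `δA′` ranges over 𝔤 = 𝔰𝔲(2)-valued
configurations (pp. 278, 285: «configurations A with values in the Lie algebra»), i.e. bondwise self-adjoint AND traceless in the `A ↦ e^{iηA}` convention; the competitor
space (150) p. 301 is a space of `SU(2)`-valued fields.  The predecessor file kept «self-adjoint» and dropped «traceless»; this file restores it.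

WHAT THIS FILE PROVES: ★★ **`tracePairing_of_isMinOn_su2`** — ✓ p604227 with `T_𝔰𝔲 = {X | (∀ b, IsSelfAdjoint (X b)) ∧ (∀ b, tr X(b) = 0) ∧ (∀ c, Q_{j(c)}X(c) = B(c)) ∧ X ∈ S}`,
the minimiser `A` bondwise traceless, and the conclusion for every self-adjoint TRACELESS `E` (the segment `A + t·(s•E)` then stays in `T_𝔰𝔲`).  HONEST SCOPE as in p604227:
bookkeeping over ✓ `FlatActionCritical.re_gradient_pairing_eq_zero_of_isMinOn_wilson`; the minimality (P5) and the chart are hypotheses — now SATISFIABLE ones.  NOT a claim about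
the crux, the rung, or the mass gap.

References: T. Bałaban, CMP **102** (1985) 277–309 [Balaban1985Variational] (5) p.278, (44) p.285, (99)–(100) p.293, (127) p.297, (150) p.301, (157)–(158) p.302;
CMP **96** (1984) 223–250 [Balaban1984PropagatorsII] (2.20) p.226.
-/

set_option autoImplicit false

noncomputable section

open scoped BigOperators Matrix.Norms.L2Operator
open NormedSpace Finset

namespace Summit.QuantumFields.YangMills.Theorems.HalvingELMinimalitySU2

open Literature.MathematicalPhysics.QuantumFieldTheory.Balaban1983to89
open B6SectADomainsV1 (Domains)
open B6SectAOperatorsV1 (BondIdx QE QE_apply)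
open LatticeFieldCalculus (bondAvgIter)
open Literature.MathematicalPhysics.QuantumFieldTheory.BalabanImbrieJaffe1984to88.BIJ85AxialPropagator411 (bondAvgIter_add bondAvgIter_smul)
open FlatActionCritical (re_gradient_pairing_eq_zero_of_isMinOn_wilson)

variable {P : Params}

/-- ★★ **THE TRACE PAIRING ON `ker Q` FROM A CONSTRAINED MINIMUM IN THE CHART, 𝔰𝔲(2)-VALUED COMPETITORS**: for
`T_𝔰𝔲 = {X | X bondwise self-adjoint ∧ X bondwise traceless ∧ (∀ c, Q_{j(c)}X(c) = B(c)) ∧ X ∈ S}` of a nested family `D`, `S` open along every line through `A`, a chart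
`U` with `↑(U X)(b) = e^{iηX(b)} ∈ SU(2)` on `T_𝔰𝔲`, and a minimiser `A ∈ T_𝔰𝔲` of `X ↦ wilsonAction4 (U X)` over `T_𝔰𝔲`: for every real `s` with `Qs = 0` on the index bonds
and every self-adjoint TRACELESS `E`, the trace pairing at `δ = s•E` has zero real part — hypothesis (i) of `HalvingA1Row165TraceSU2.row165_of_tracePairing_L5_su2`.
[cite: Balaban1985Variational, (99)-(100) p.293, (127) p.297, (150) p.301, (157)-(158) p.302] -/
theorem tracePairing_of_isMinOn_su2 (D : Domains P) (η : ℝ) (W : (PBond P 0 → Matrix (Fin 2) (Fin 2) ℂ) → (PBond P 0 → Matrix (Fin 2) (Fin 2) ℂ))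
    (hSd : Differentiable ℂ (fun A : PBond P 0 → Matrix (Fin 2) (Fin 2) ℂ => (∑ p : Plaq P 0, (1 - (2 : ℂ)⁻¹ * Matrix.trace (exp ((Complex.I * (η : ℂ)) • A ⟨p.src, p.μ⟩) * exp ((Complex.I * (η : ℂ)) • A ⟨p.src.shift p.μ, p.ν⟩) * exp (-((Complex.I * (η : ℂ)) • A ⟨p.src.shift p.ν, p.μ⟩)) * exp (-((Complex.I * (η : ℂ)) • A ⟨p.src, p.ν⟩)))))))
    (hgrad : ∀ A δ : PBond P 0 → Matrix (Fin 2) (Fin 2) ℂ, fderiv ℂ (fun A : PBond P 0 → Matrix (Fin 2) (Fin 2) ℂ => (∑ p : Plaq P 0, (1 - (2 : ℂ)⁻¹ * Matrix.trace (exp ((Complex.I * (η : ℂ)) • A ⟨p.src, p.μ⟩) * exp ((Complex.I * (η : ℂ)) • A ⟨p.src.shift p.μ, p.ν⟩) * exp (-((Complex.I * (η : ℂ)) • A ⟨p.src.shift p.ν, p.μ⟩)) * exp (-((Complex.I * (η : ℂ)) • A ⟨p.src, p.ν⟩)))))) A δ =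
      ((η : ℂ) ^ 2 / 2) * ∑ p : Plaq P 0, Matrix.trace ((A ⟨p.src, p.μ⟩ + A ⟨p.src.shift p.μ, p.ν⟩ - A ⟨p.src.shift p.ν, p.μ⟩ - A ⟨p.src, p.ν⟩) * (δ ⟨p.src, p.μ⟩ + δ ⟨p.src.shift p.μ, p.ν⟩ - δ ⟨p.src.shift p.ν, p.μ⟩ - δ ⟨p.src, p.ν⟩)) + (η : ℂ) ^ 4 * ∑ b : PBond P 0, Matrix.trace (W A b * δ b))
    {S : Set (PBond P 0 → Matrix (Fin 2) (Fin 2) ℂ)} {Bdat : BondIdx D → Matrix (Fin 2) (Fin 2) ℂ}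
    (U : (PBond P 0 → Matrix (Fin 2) (Fin 2) ℂ) → GaugeField P 0 (Matrix.specialUnitaryGroup (Fin 2) ℂ))
    (hU : ∀ X ∈ {X : PBond P 0 → Matrix (Fin 2) (Fin 2) ℂ | (∀ b, IsSelfAdjoint (X b)) ∧ (∀ b, Matrix.trace (X b) = 0) ∧ (∀ c : BondIdx D, bondAvgIter (c.1.1 : ℕ) X c.1.2 = Bdat c) ∧ X ∈ S},
      ∀ b, ((U X b : Matrix.specialUnitaryGroup (Fin 2) ℂ) : Matrix (Fin 2) (Fin 2) ℂ) = exp ((Complex.I * (η : ℂ)) • X b))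
    {A : PBond P 0 → Matrix (Fin 2) (Fin 2) ℂ} (hAsa : ∀ b, IsSelfAdjoint (A b)) (hAtr : ∀ b, Matrix.trace (A b) = 0) (hAQ : ∀ c : BondIdx D, bondAvgIter (c.1.1 : ℕ) A c.1.2 = Bdat c) (hAS : A ∈ S)
    (hS : ∀ δ : PBond P 0 → Matrix (Fin 2) (Fin 2) ℂ, ∃ r : ℝ, 0 < r ∧ ∀ t : ℝ, |t| < r → A + t • δ ∈ S)
    (hmin : IsMinOn (fun X => wilsonAction4 (U X))
      {X : PBond P 0 → Matrix (Fin 2) (Fin 2) ℂ | (∀ b, IsSelfAdjoint (X b)) ∧ (∀ b, Matrix.trace (X b) = 0) ∧ (∀ c : BondIdx D, bondAvgIter (c.1.1 : ℕ) X c.1.2 = Bdat c) ∧ X ∈ S} A) :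
    ∀ s : PBond P 0 → ℝ, QE D (WithLp.toLp 2 s) = 0 → ∀ E : Matrix (Fin 2) (Fin 2) ℂ, IsSelfAdjoint E → Matrix.trace E = 0 →
    (((η : ℂ) ^ 2 / 2) * ∑ p : Plaq P 0, Matrix.trace ((A ⟨p.src, p.μ⟩ + A ⟨p.src.shift p.μ, p.ν⟩ - A ⟨p.src.shift p.ν, p.μ⟩ - A ⟨p.src, p.ν⟩) * (((s ⟨p.src, p.μ⟩ : ℝ) : ℂ) • E + ((s ⟨p.src.shift p.μ, p.ν⟩ : ℝ) : ℂ) • E - ((s ⟨p.src.shift p.ν, p.μ⟩ : ℝ) : ℂ) • E - ((s ⟨p.src, p.ν⟩ : ℝ) : ℂ) • E)) + (η : ℂ) ^ 4 * ∑ b : PBond P 0, Matrix.trace (W A b * (((s b : ℝ) : ℂ) • E))).re = 0 := by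
  intro s hs E hE hEtr
  set δ : PBond P 0 → Matrix (Fin 2) (Fin 2) ℂ := fun b => ((s b : ℝ) : ℂ) • E with hδdef
  obtain ⟨r, hr, hSr⟩ := hS δ
  have hQs : ∀ c : BondIdx D, bondAvgIter (c.1.1 : ℕ) s c.1.2 = 0 := fun c => by
    have h := congrArg (fun v : B6SectAOperatorsV1.BondIdxSpace D => v c) hs
    simpa [QE_apply] using h
  have hδφ : δ = fun b => (LinearMap.toSpanSingleton ℝ (Matrix (Fin 2) (Fin 2) ℂ) E) (s b) := by
    funext b
    show ((s b : ℝ) : ℂ) • E = (LinearMap.toSpanSingleton ℝ (Matrix (Fin 2) (Fin 2) ℂ) E) (s b)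
    rw [LinearMap.toSpanSingleton_apply, Complex.coe_smul]
  have hT : ∀ t : ℝ, |t| < r →
      A + t • δ ∈ {X : PBond P 0 → Matrix (Fin 2) (Fin 2) ℂ | (∀ b, IsSelfAdjoint (X b)) ∧ (∀ b, Matrix.trace (X b) = 0) ∧ (∀ c : BondIdx D, bondAvgIter (c.1.1 : ℕ) X c.1.2 = Bdat c) ∧ X ∈ S} := by
    intro t ht
    refine ⟨fun b => ?_, fun b => ?_, fun c => ?_, hSr t ht⟩
    · -- the segment stays bondwise self-adjoint
      show IsSelfAdjoint (A b + t • (((s b : ℝ) : ℂ) • E))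
      rw [Complex.coe_smul]
      exact (hAsa b).add (IsSelfAdjoint.smul (IsSelfAdjoint.all t) (IsSelfAdjoint.smul (IsSelfAdjoint.all (s b)) hE))
    · -- the segment stays bondwise traceless
      show Matrix.trace (A b + t • (((s b : ℝ) : ℂ) • E)) = 0
      rw [Matrix.trace_add, Matrix.trace_smul, Matrix.trace_smul, hAtr b, hEtr, smul_zero, smul_zero, add_zero]
    · -- the segment keeps every constraint: `Q(s•E) = (Qs)•E = 0`
      rw [bondAvgIter_add, bondAvgIter_smul, Pi.add_apply, Pi.smul_apply, hAQ c, hδφ,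
        ChartHInv.bondAvgIter_comp_apply (LinearMap.toSpanSingleton ℝ (Matrix (Fin 2) (Fin 2) ℂ) E) (c.1.1 : ℕ) s c.1.2, hQs c, map_zero, smul_zero, add_zero]
  have h := re_gradient_pairing_eq_zero_of_isMinOn_wilson η W hSd hgrad
    (T := {X : PBond P 0 → Matrix (Fin 2) (Fin 2) ℂ | (∀ b, IsSelfAdjoint (X b)) ∧ (∀ b, Matrix.trace (X b) = 0) ∧ (∀ c : BondIdx D, bondAvgIter (c.1.1 : ℕ) X c.1.2 = Bdat c) ∧ X ∈ S})
    (fun X hX => hX.1) U hU (A := A) (δ := δ) ⟨hAsa, hAtr, hAQ, hAS⟩ hr hT hmin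
  exact h

end Summit.QuantumFields.YangMills.Theorems.HalvingELMinimalitySU2

end
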